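import Mathlib.GroupTheory.PGroup
import Mathlib.Data.ZMod.Basic
import Mathlib.Tactic.DeriveFintype
import Mathlib.Tactic.LinearCombination

/-!
# `Capture` (stmt-PneNP-2659) — negative lemma, part 1/2: the `D₄` instance and the pseudo-solution calculus

Conjecture J of line `csp-spine-meet-to-join` (registered stub `stub_pGroupJuntaCompleteness`, rev 6: scope-junta
`ZMod |G|` span programs refute every unsatisfiable coset-CSP instance over a finite p-group) is FALSE; part 2
(`JuntaIncompleteness.lean`) proves `¬` it. This part: the group `DH ≅ D₄` (Heisenberg triples over `ZMod 2`), the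
instance (10 variables, 8 ternary coset constraints: `scope`, `P8`/`H`, `crep`), `unsat` (eight `ZMod 2` identities:
the central coordinates sum to `x1¹x1² + x2¹x2² + 1` while the first two coordinates force `x̄1 = x̄2`), and the
pairing calculus of integer chains coded in base 8 (`pair`, `feature_sum_eq`, `pair_eq_mass_mul`, `pair_eq_of_perm`:
chains with the same signed code multiset pair identically with every feature weight). Mechanism and provenance:
`Cruxes/Capture/Lines/csp-spine-meet-to-join-juntaJ-refuted-c3.md` (Zhuk's `D₄` instance, arXiv:2509.18434 §4.4, made
passenger-free by one equality hop). Lead prover-line-stmt-PneNP-2659-c3-0, 2026-08-16.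
-/


namespace Summit.PneNP.PneNP.Theorems.Capture.Negative

set_option linter.dupNamespace false

/-- The dihedral group of order 8 as Heisenberg triples over `ZMod 2`. -/
@[ext] structure DH where
  /-- first coordinate -/ a : ZMod 2
  /-- second coordinate -/ b : ZMod 2
  /-- central coordinate -/ z : ZMod 2
  deriving DecidableEq, Fintype

namespace DH

/-- Heisenberg multiplication `(a,b,z)·(a',b',z') = (a+a', b+b', z+z'+ab')`. -/
instance : Mul DH := ⟨fun x y => ⟨x.a + y.a, x.b + y.b, x.z + y.z + x.a * y.b⟩⟩
/-- The identity `(0,0,0)`. -/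
instance : One DH := ⟨⟨0, 0, 0⟩⟩
/-- The inverse `(a,b,z)⁻¹ = (a,b,z+ab)`. -/
instance : Inv DH := ⟨fun x => ⟨x.a, x.b, x.z + x.a * x.b⟩⟩

/-- Component formula. -/ @[simp] theorem mul_a (x y : DH) : (x * y).a = x.a + y.a := rfl
/-- Component formula. -/ @[simp] theorem mul_b (x y : DH) : (x * y).b = x.b + y.b := rfl
/-- Component formula. -/ @[simp] theorem mul_z (x y : DH) : (x * y).z = x.z + y.z + x.a * y.b := rfl
/-- Component formula. -/ @[simp] theorem one_a : (1 : DH).a = 0 := rfl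
/-- Component formula. -/ @[simp] theorem one_b : (1 : DH).b = 0 := rfl
/-- Component formula. -/ @[simp] theorem one_z : (1 : DH).z = 0 := rfl
/-- Component formula. -/ @[simp] theorem inv_a (x : DH) : x⁻¹.a = x.a := rfl
/-- Component formula. -/ @[simp] theorem inv_b (x : DH) : x⁻¹.b = x.b := rfl
/-- Component formula. -/ @[simp] theorem inv_z (x : DH) : x⁻¹.z = x.z + x.a * x.b := rfl

/-- `DH` is a group (it is the dihedral group of order 8). -/
instance : Group DH where
  mul_assoc x y w := by ext <;> simp <;> ring
  one_mul x := by ext <;> simp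
  mul_one x := by ext <;> simp
  inv_mul_cancel x := by
    ext <;> simp
    · linear_combination x.a * (by decide : (2 : ZMod 2) = 0)
    · linear_combination x.b * (by decide : (2 : ZMod 2) = 0)
    · linear_combination (x.z + x.a * x.b) * (by decide : (2 : ZMod 2) = 0)

/-- `|DH| = 8 = 2³`, so `DH` is a 2-group. -/
theorem card : Fintype.card DH = 8 := by rfl

/-- The swap automorphism `ψ (a,b,z) = (b,a,z+ab)`. -/
def psi (x : DH) : DH := ⟨x.b, x.a, x.z + x.a * x.b⟩
/-- The central involution `ζ = (0,0,1)`. -/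
def zeta : DH := ⟨0, 0, 1⟩

/-- Component formula. -/ @[simp] theorem psi_a (x : DH) : (psi x).a = x.b := rfl
/-- Component formula. -/ @[simp] theorem psi_b (x : DH) : (psi x).b = x.a := rfl
/-- Component formula. -/ @[simp] theorem psi_z (x : DH) : (psi x).z = x.z + x.a * x.b := rfl
/-- Component formula. -/ @[simp] theorem zeta_a : zeta.a = 0 := rfl
/-- Component formula. -/ @[simp] theorem zeta_b : zeta.b = 0 := rfl
/-- Component formula. -/ @[simp] theorem zeta_z : zeta.z = 1 := rfl

/-- `ψ` is multiplicative. -/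
theorem psi_mul (x y : DH) : psi (x * y) = psi x * psi y := by
  ext
  · simp
  · simp
  · simp only [psi_z, mul_z, mul_a, mul_b, psi_a, psi_b]
    linear_combination (x.a * y.b) * (by decide : (2 : ZMod 2) = 0)

/-- `ψ` commutes with inversion. -/
theorem psi_inv (x : DH) : psi x⁻¹ = (psi x)⁻¹ := by
  ext
  · simp
  · simp
  · simp only [psi_z, inv_z, inv_a, inv_b, psi_a, psi_b]
    ring

end DH

open DH

/-! ## The instance: 10 variables `x1 x2 x3 p y1 y2 y3 q w x3'` (indices 0..9), 8 ternary constraints -/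

/-- A subgroup of `Fin 3 → DH` cut out by a predicate (closure proofs supplied). -/
def predSubgroup (P : (Fin 3 → DH) → Prop) (h1 : P 1) (hm : ∀ x y, P x → P y → P (x * y))
    (hi : ∀ x, P x → P x⁻¹) : Subgroup (Fin 3 → DH) where
  carrier := {t | P t}
  one_mem' := h1
  mul_mem' := fun hx hy => hm _ _ hx hy
  inv_mem' := fun hx => hi _ hx

/-- Membership in a predicate subgroup is the predicate. -/
@[simp] theorem mem_predSubgroup {P : (Fin 3 → DH) → Prop} {h1 hm hi} (t : Fin 3 → DH) :
    t ∈ predSubgroup P h1 hm hi ↔ P t := Iff.rfl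

/-- Type `P1`: first coordinates equal, `b₀ + b₁ = b₂`, `z₀ + z₁ = z₂`. -/
def IsP1 (t : Fin 3 → DH) : Prop :=
  (t 0).a = (t 2).a ∧ (t 1).a = (t 2).a ∧ (t 0).b + (t 1).b = (t 2).b ∧ (t 0).z + (t 1).z = (t 2).z
/-- Type `P2`: second coordinates equal, `a₀ + a₁ = a₂`, `z₀ + z₁ = z₂`. -/
def IsP2 (t : Fin 3 → DH) : Prop :=
  (t 0).b = (t 2).b ∧ (t 1).b = (t 2).b ∧ (t 0).a + (t 1).a = (t 2).a ∧ (t 0).z + (t 1).z = (t 2).z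
/-- Graph of `ψ` (third slot repeats the second): `t₁ = ψ t₀`, `t₂ = ψ t₀`. -/
def IsR (t : Fin 3 → DH) : Prop := t 1 = psi (t 0) ∧ t 2 = psi (t 0)
/-- Diagonal: `t₁ = t₀`, `t₂ = t₀`. -/
def IsE (t : Fin 3 → DH) : Prop := t 1 = t 0 ∧ t 2 = t 0

/-- `P1` is a subgroup (the cross term `a·b'` cancels because the first coordinates agree). -/
theorem isP1_sub : (IsP1 1) ∧ (∀ x y, IsP1 x → IsP1 y → IsP1 (x * y)) ∧ (∀ x, IsP1 x → IsP1 x⁻¹) := by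
  refine ⟨by simp [IsP1], ?_, ?_⟩
  · rintro x y ⟨h1, h2, h3, h4⟩ ⟨k1, k2, k3, k4⟩
    refine ⟨?_, ?_, ?_, ?_⟩ <;> simp only [Pi.mul_apply, mul_a, mul_b, mul_z]
    · rw [h1, k1]
    · rw [h2, k2]
    · linear_combination h3 + k3
    · linear_combination h4 + k4 + (y 0).b * h1 + (y 1).b * h2 - (x 2).a * k3
        + ((y 0).b * (x 2).a + (y 1).b * (x 2).a - (x 2).a * (y 2).b) * (by decide : (2 : ZMod 2) = 0)
  · rintro x ⟨h1, h2, h3, h4⟩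
    refine ⟨?_, ?_, ?_, ?_⟩ <;> simp only [Pi.inv_apply, inv_a, inv_b, inv_z]
    · rw [h1]
    · rw [h2]
    · linear_combination h3
    · linear_combination h4 + (x 0).b * h1 + (x 1).b * h2 - (x 2).a * h3
        + ((x 0).b * (x 2).a + (x 1).b * (x 2).a - (x 2).a * (x 2).b) * (by decide : (2 : ZMod 2) = 0)

/-- `P2` is a subgroup. -/
theorem isP2_sub : (IsP2 1) ∧ (∀ x y, IsP2 x → IsP2 y → IsP2 (x * y)) ∧ (∀ x, IsP2 x → IsP2 x⁻¹) := by
  refine ⟨by simp [IsP2], ?_, ?_⟩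
  · rintro x y ⟨h1, h2, h3, h4⟩ ⟨k1, k2, k3, k4⟩
    refine ⟨?_, ?_, ?_, ?_⟩ <;> simp only [Pi.mul_apply, mul_a, mul_b, mul_z]
    · rw [h1, k1]
    · rw [h2, k2]
    · linear_combination h3 + k3
    · linear_combination h4 + k4 + (x 0).a * k1 + (x 1).a * k2 - (y 2).b * h3
        + ((x 0).a * (y 2).b + (x 1).a * (y 2).b - (y 2).b * (x 2).a) * (by decide : (2 : ZMod 2) = 0)
  · rintro x ⟨h1, h2, h3, h4⟩
    refine ⟨?_, ?_, ?_, ?_⟩ <;> simp only [Pi.inv_apply, inv_a, inv_b, inv_z]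
    · rw [h1]
    · rw [h2]
    · linear_combination h3
    · linear_combination h4 + (x 0).a * h1 + (x 1).a * h2 - (x 2).b * h3
        + ((x 0).a * (x 2).b + (x 1).a * (x 2).b - (x 2).b * (x 2).a) * (by decide : (2 : ZMod 2) = 0)

/-- The graph of `ψ` is a subgroup. -/
theorem isR_sub : (IsR 1) ∧ (∀ x y, IsR x → IsR y → IsR (x * y)) ∧ (∀ x, IsR x → IsR x⁻¹) := by
  refine ⟨⟨rfl, rfl⟩, ?_, ?_⟩
  · rintro x y ⟨h1, h2⟩ ⟨k1, k2⟩
    exact ⟨by rw [Pi.mul_apply, Pi.mul_apply, h1, k1, psi_mul],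
      by rw [Pi.mul_apply, Pi.mul_apply, h2, k2, psi_mul]⟩
  · rintro x ⟨h1, h2⟩
    exact ⟨by rw [Pi.inv_apply, Pi.inv_apply, h1, psi_inv], by rw [Pi.inv_apply, Pi.inv_apply, h2, psi_inv]⟩

/-- The diagonal is a subgroup. -/
theorem isE_sub : (IsE 1) ∧ (∀ x y, IsE x → IsE y → IsE (x * y)) ∧ (∀ x, IsE x → IsE x⁻¹) := by
  refine ⟨⟨rfl, rfl⟩, ?_, ?_⟩
  · rintro x y ⟨h1, h2⟩ ⟨k1, k2⟩
    exact ⟨by rw [Pi.mul_apply, Pi.mul_apply, h1, k1], by rw [Pi.mul_apply, Pi.mul_apply, h2, k2]⟩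
  · rintro x ⟨h1, h2⟩
    exact ⟨by rw [Pi.inv_apply, Pi.inv_apply, h1], by rw [Pi.inv_apply, Pi.inv_apply, h2]⟩

/-- Scopes of the 8 constraints (third slot of the binary ones repeats the second variable). -/
def scope : Fin 8 → Fin 3 → Fin 10 :=
  ![![0, 1, 3], ![2, 8, 3], ![4, 5, 7], ![6, 8, 7], ![0, 4, 4], ![1, 5, 5], ![2, 9, 9], ![9, 6, 6]]

/-- The 8 defining predicates. -/
def P8 : Fin 8 → (Fin 3 → DH) → Prop := ![IsP1, IsP1, IsP2, IsP2, IsR, IsR, IsE, IsE]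

/-- Closure properties of the 8 predicates. -/
theorem P8_sub (j : Fin 8) : (P8 j 1) ∧ (∀ x y, P8 j x → P8 j y → P8 j (x * y)) ∧ (∀ x, P8 j x → P8 j x⁻¹) := by
  fin_cases j
  exacts [isP1_sub, isP1_sub, isP2_sub, isP2_sub, isR_sub, isR_sub, isE_sub, isE_sub]

/-- The 8 subgroups. -/
def H (j : Fin 8) : Subgroup (Fin 3 → DH) := predSubgroup (P8 j) (P8_sub j).1 (P8_sub j).2.1 (P8_sub j).2.2

/-- Membership in `H j` is the predicate `P8 j`. -/
theorem mem_H {j : Fin 8} (t : Fin 3 → DH) : t ∈ H j ↔ P8 j t := Iff.rfl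

/-- decidability -/ instance : DecidablePred IsP1 := fun t => by unfold IsP1; infer_instance
/-- decidability -/ instance : DecidablePred IsP2 := fun t => by unfold IsP2; infer_instance
/-- decidability -/ instance : DecidablePred IsR := fun t => by unfold IsR; infer_instance
/-- decidability -/ instance : DecidablePred IsE := fun t => by unfold IsE; infer_instance

/-- Decidability of the 8 predicates, by cases on the index (kernel-friendly). -/
instance instDecidableP8 (j : Fin 8) (t : Fin 3 → DH) : Decidable (P8 j t) :=
  match j with
  | 0 => inferInstanceAs (Decidable (IsP1 t))
  | 1 => inferInstanceAs (Decidable (IsP1 t))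
  | 2 => inferInstanceAs (Decidable (IsP2 t))
  | 3 => inferInstanceAs (Decidable (IsP2 t))
  | 4 => inferInstanceAs (Decidable (IsR t))
  | 5 => inferInstanceAs (Decidable (IsR t))
  | 6 => inferInstanceAs (Decidable (IsE t))
  | 7 => inferInstanceAs (Decidable (IsE t))

/-- Coset representatives: identity except for the last constraint `y3 = x3' · ζ`. -/
def crep : Fin 8 → Fin 3 → DH := ![1, 1, 1, 1, 1, 1, 1, ![1, zeta, zeta]]

/-- The constraint predicate of the stub, specialised. -/
def Sat (h : Fin 10 → DH) (j : Fin 8) : Prop := (crep j)⁻¹ * (fun i => h (scope j i)) ∈ H j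

/-- **UNSAT.** No assignment satisfies all eight constraints. -/
theorem unsat : ¬ ∃ h : Fin 10 → DH, ∀ j : Fin 8, Sat h j := by
  rintro ⟨h, hh⟩
  have e0 := hh 0; have e1 := hh 1; have e2 := hh 2; have e3 := hh 3
  have e4 := hh 4; have e5 := hh 5; have e6 := hh 6; have e7 := hh 7
  simp only [Sat, mem_H, P8, crep, scope, IsP1, IsP2, IsR, IsE,
    Matrix.cons_val_zero, Matrix.cons_val_one, Matrix.cons_val, inv_one, one_mul,
    Pi.mul_apply, Pi.inv_apply, DH.ext_iff, psi_a, psi_b, psi_z, mul_a, mul_b, mul_z, inv_a, inv_b, inv_z,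
    zeta_a, zeta_b, zeta_z, zero_add, add_zero, zero_mul, mul_zero] at e0 e1 e2 e3 e4 e5 e6 e7
  obtain ⟨a0e, a1e, b0e, z0e⟩ := e0
  obtain ⟨-, -, b1e, z1e⟩ := e1
  obtain ⟨-, -, -, z2e⟩ := e2
  obtain ⟨b3e, b3f, -, z3e⟩ := e3
  obtain ⟨⟨-, -, z4e⟩, -⟩ := e4
  obtain ⟨⟨-, -, z5e⟩, -⟩ := e5
  obtain ⟨⟨-, b6e, z6e⟩, -⟩ := e6
  obtain ⟨⟨-, b7e, z7e⟩, -⟩ := e7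
  have key : (h 0).a * (h 0).b + (h 1).a * (h 1).b + 1 = 0 := by
    linear_combination -(z0e) + z1e + z2e - z3e - z4e - z5e + z6e + z7e
  have h10 : (1 : ZMod 2) = 0 := by
    linear_combination key - (h 0).b * a0e - (h 1).b * a1e - (h 3).a * b0e + (h 3).a * b1e
      - (h 3).a * b3f + (h 3).a * b3e - (h 3).a * b7e - (h 3).a * b6e - ((h 3).a * (h 2).b) * (by decide : (2 : ZMod 2) = 0)
  exact one_ne_zero h10

/-! ## The integer pseudo-solution: eight chains with identical scope marginals and mass 1 -/

/-- Decode a base-8 digit `d ↦ (d % 2, d/2 % 2, d/4 % 2)`. -/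
def ofCode (d : ℕ) : DH := ⟨((d % 2 : ℕ) : ZMod 2), ((d / 2 % 2 : ℕ) : ZMod 2), ((d / 4 % 2 : ℕ) : ZMod 2)⟩

/-- The `i`-th base-8 digit of `n`. -/
def digit (n : ℕ) (i : Fin 10) : ℕ := n / 8 ^ (i : ℕ) % 8

/-- The assignment `Fin 10 → DH` encoded by `n`. -/
def pt (n : ℕ) : Fin 10 → DH := fun i => ofCode (digit n i)

/-- Feature index type of the stub for this instance (`r j = 3` for every `j`). -/
abbrev Key := Σ _ : Fin 8, (Fin 3 → DH)

/-- The coefficient ring of the stub for this instance. -/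
abbrev R8 := ZMod (Fintype.card DH)

/-- Pairing of a chain with a feature weight `w`: `Σ_(n,c) c · Σ_j' w ⟨j', (pt n) ∘ scope j'⟩`. -/
def pair (L : List (ℕ × ℤ)) (w : Key → R8) : R8 :=
  (L.map fun nc => (nc.2 : R8) * ∑ j : Fin 8, w ⟨j, fun i => pt nc.1 (scope j i)⟩).sum

/-- Pairing of the empty chain. -/
theorem pair_nil (w : Key → R8) : pair [] w = 0 := rfl

/-- Pairing, one point peeled off. -/
theorem pair_cons (nc : ℕ × ℤ) (L : List (ℕ × ℤ)) (w : Key → R8) :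
    pair (nc :: L) w = (nc.2 : R8) * (∑ j : Fin 8, w ⟨j, fun i => pt nc.1 (scope j i)⟩) + pair L w := rfl

/-- The pairing is additive in the feature weight. -/
theorem pair_add (L : List (ℕ × ℤ)) (w₁ w₂ : Key → R8) : pair L (w₁ + w₂) = pair L w₁ + pair L w₂ := by
  induction L with
  | nil => simp [pair_nil]
  | cons nc L ih =>
    rw [pair_cons, pair_cons, pair_cons, ih]
    simp only [Pi.add_apply, Finset.sum_add_distrib, mul_add]
    ring

/-! ### Collapsing the feature sum of the stub at a point -/

/-- At an assignment `h`, the weighted feature sum of the stub collapses to the eight scope keys of `h`. -/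
theorem feature_sum_eq (w : Key → R8) (h : Fin 10 → DH) :
    (∑ ja : Key, w ja * (if (fun i => h (scope ja.1 i)) = ja.2 then 1 else 0)) =
      ∑ j : Fin 8, w ⟨j, fun i => h (scope j i)⟩ := by
  rw [← Finset.univ_sigma_univ, Finset.sum_sigma]
  refine Finset.sum_congr rfl fun j _ => ?_
  simp only [mul_ite, mul_one, mul_zero]
  rw [Finset.sum_ite_eq]
  simp

/-- If every point of a chain gives feature sum `b`, the pairing is `(mass of the chain) · b`. -/
theorem pair_eq_mass_mul (L : List (ℕ × ℤ)) (w : Key → R8) (b : R8)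
    (hL : ∀ nc ∈ L, (∑ j : Fin 8, w ⟨j, fun i => pt nc.1 (scope j i)⟩) = b) :
    pair L w = ((L.map Prod.snd).sum : ℤ) * b := by
  induction L with
  | nil => simp [pair_nil]
  | cons nc L ih =>
    rw [pair_cons, hL nc (by simp), ih fun nc' h' => hL nc' (by simp [h'])]
    simp only [List.map_cons, List.sum_cons, Int.cast_add]
    ring

/-! ### Marginal equality via code multisets -/

/-- Code of the `j`-th scope key of the point `n`: `512·j + d₀ + 8·d₁ + 64·d₂`. -/
def keyCode (n : ℕ) (j : Fin 8) : ℕ :=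
  512 * (j : ℕ) + digit n (scope j 0) + 8 * digit n (scope j 1) + 64 * digit n (scope j 2)

/-- Decoding a code to a key. -/
def keyOf (N : ℕ) : Key :=
  ⟨⟨N / 512 % 8, Nat.mod_lt _ (by norm_num)⟩, ![ofCode (N % 8), ofCode (N / 8 % 8), ofCode (N / 64 % 8)]⟩

/-- Digits are `< 8`. -/
theorem digit_lt (n : ℕ) (i : Fin 10) : digit n i < 8 := Nat.mod_lt _ (by norm_num)

/-- Decoding a code gives back the scope key (base-8 arithmetic, `omega`). -/
theorem keyOf_keyCode (n : ℕ) (j : Fin 8) : keyOf (keyCode n j) = ⟨j, fun i => pt n (scope j i)⟩ := by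
  have h0 := digit_lt n (scope j 0); have h1 := digit_lt n (scope j 1); have h2 := digit_lt n (scope j 2)
  have hj := j.isLt
  have q3 : keyCode n j / 512 % 8 = (j : ℕ) := by unfold keyCode; omega
  have q0 : keyCode n j % 8 = digit n (scope j 0) := by unfold keyCode; omega
  have q1 : keyCode n j / 8 % 8 = digit n (scope j 1) := by unfold keyCode; omega
  have q2 : keyCode n j / 64 % 8 = digit n (scope j 2) := by unfold keyCode; omega
  unfold keyOf
  refine Sigma.ext (Fin.ext (by simpa using q3)) (heq_of_eq ?_)
  funext i
  fin_cases i <;> simp [pt, q0, q1, q2]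

/-- Pairing through codes: `pairN L u = Σ_(n,c) c · Σ_j u (keyCode n j)`. -/
def pairN (L : List (ℕ × ℤ)) (u : ℕ → R8) : R8 :=
  (L.map fun nc => (nc.2 : R8) * ∑ j : Fin 8, u (keyCode nc.1 j)).sum

/-- The pairing factors through the codes. -/
theorem pair_eq_pairN (L : List (ℕ × ℤ)) (w : Key → R8) : pair L w = pairN L (w ∘ keyOf) := by
  unfold pair pairN
  congr 1
  refine List.map_congr_left fun nc _ => ?_
  congr 1
  refine Finset.sum_congr rfl fun j _ => ?_
  rw [Function.comp_apply, keyOf_keyCode]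

/-- The eight codes of a point. -/
def codes1 (n : ℕ) : List ℕ :=
  [keyCode n 0, keyCode n 1, keyCode n 2, keyCode n 3, keyCode n 4, keyCode n 5, keyCode n 6, keyCode n 7]

/-- Sum over the eight codes of a point. -/
theorem sum_codes1 (n : ℕ) (u : ℕ → R8) : ((codes1 n).map u).sum = ∑ j : Fin 8, u (keyCode n j) := by
  simp [codes1, Fin.sum_univ_eight]
  ring

/-- `k` concatenated copies of a list. -/
def rep (k : ℕ) (l : List ℕ) : List ℕ := (List.replicate k l).flatten

/-- Sum over `k` copies. -/
theorem sum_rep (k : ℕ) (l : List ℕ) (u : ℕ → R8) : ((rep k l).map u).sum = (k : R8) * (l.map u).sum := by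
  induction k with
  | zero => simp [rep]
  | succ k ih =>
    simp only [rep, List.replicate_succ, List.flatten_cons, List.map_append, List.sum_append] at ih ⊢
    rw [ih]; push_cast; ring

/-- The multiset of codes of a chain, positive part (multiplicity `c⁺`). -/
def posCodes : List (ℕ × ℤ) → List ℕ
  | [] => []
  | nc :: L => rep nc.2.toNat (codes1 nc.1) ++ posCodes L
/-- The multiset of codes of a chain, negative part (multiplicity `c⁻`). -/
def negCodes : List (ℕ × ℤ) → List ℕ
  | [] => []
  | nc :: L => rep (-nc.2).toNat (codes1 nc.1) ++ negCodes L

/-- The code pairing is (positive code multiset) − (negative code multiset), summed against `u`. -/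
theorem pairN_eq (L : List (ℕ × ℤ)) (u : ℕ → R8) :
    pairN L u = ((posCodes L).map u).sum - ((negCodes L).map u).sum := by
  induction L with
  | nil => simp [pairN, posCodes, negCodes]
  | cons nc L ih =>
    have hcons : pairN (nc :: L) u = (nc.2 : R8) * (∑ j : Fin 8, u (keyCode nc.1 j)) + pairN L u := rfl
    rw [hcons, ih]
    simp only [posCodes, negCodes, List.map_append, List.sum_append, sum_rep, sum_codes1]
    have hc : ((nc.2.toNat : ℕ) : R8) - (((-nc.2).toNat : ℕ) : R8) = (nc.2 : R8) := by
      have := congrArg (Int.cast : ℤ → R8) (Int.toNat_sub_toNat_neg nc.2)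
      push_cast at this
      exact this
    rw [← hc]
    ring

/-- **Bridge.** If the signed code multisets of two chains agree (as a permutation of
`pos L ++ neg L'` and `pos L' ++ neg L`), the two chains pair identically with every feature weight. -/
theorem pair_eq_of_perm (L L' : List (ℕ × ℤ))
    (hp : (posCodes L ++ negCodes L').Perm (posCodes L' ++ negCodes L)) (w : Key → R8) :
    pair L w = pair L' w := by
  rw [pair_eq_pairN, pair_eq_pairN, pairN_eq, pairN_eq]
  have := hp.map (w ∘ keyOf)
  have hs := this.sum_eq
  simp only [List.map_append, List.sum_append] at hs
  linear_combination hs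

end Summit.PneNP.PneNP.Theorems.Capture.Negative
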